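import Mathlib.Analysis.Complex.RealDeriv
import Literature.Geometry.Lorentzian.TeukolskyWronskianBound
import Literature.Geometry.Lorentzian.KerrSurfaceGravity
import Literature.Geometry.Lorentzian.KerrSeparatedPotential

/-!
# The scalar radial Teukolsky ODE is exactly of Olver's form in the blown-up radius
# (stub `stub_olverNormalForm`, S1 of the line `olver-dunster-uniform-reduction`)

Crux `PhaseMixingCapture.KappaExplicitWaveDecay` (stmt-FinalStateConjecture-10654), line
`olver-dunster-uniform-reduction`, stub S1. Notation: `d = r₊ − r₋ = 2√(M² − a²) > 0`
(sub-extremality), `φ(y) = r₊ + d·y` (so `x = (r − r₊)/d` is the blown-up radius), `P = y(y+1)`,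
`ρ = √P`, `K = ω(r² + a²) − am` (`Kerr.radialK`), `Λ′ = Λ − 2amω`.

**(i) Liouville normal form.** With `λ = Λ − a²ω²` the `s = 0` case of
`Kerr.IsRadialTeukolskySolution` reads `Δ R″ + 2(r − M) R′ + (K²/Δ − Λ′) R = 0` on `r > r₊`
(`isRadialTeukolskySolution_iff`). Along `r = φ(x)`, `x > 0`, one has `Δ = d²·x(x+1)`
(`Kerr.delta_eq_mul`) and `2(r − M) = d(2x + 1)` (`r₊ − M = d/2`). For ANY function `f`, any map
`θ` with `θ′(y) = q` and any `C²` weight `μ`, the function `z ↦ μ(z)·f(θ z)` has first and second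
derivative `μ′f + μ q f′`, `μ″ f + 2μ′ q f′ + μ q² f″` at the point (`hasDerivAt_liouville`, product
and chain rule in `HasDerivAt`). Forward: `W = ρ·(R ∘ φ)` with `ρ′ = (2y+1)/(2ρ)`,
`ρ″ = −1/(4ρ³)` (here `(2y+1)² − 4P = 1` is used); substituting `R″` from the ODE, the identity
`W″ = ((Λ′P − (K/d)² − ¼)/P²)·W` is a rational identity in `ρ, x, d, K, Λ′` once `P` is replaced
by `ρ²` (`field_simp; ring`). Backward: `R = (ρ⁻¹·W) ∘ ψ` near every `r > r₊`, `ψ = φ⁻¹`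
(`HasDerivAt.congr_of_eventuallyEq` on the open half-line), with `(ρ⁻¹)′ = −ρ′/ρ²`,
`(ρ⁻¹)″ = (1 + 2(2y+1)²)/(4ρ⁵)`; substituting `W″` from the normal form, the radial ODE is again
a rational identity.

**(ii) Double pole.** For `x > 0`, `x²·coef(x) = (Λ′x(x+1) − (K(φ x)/d)² − ¼)/(x+1)²`, a function
continuous at `0` with value `−(K(r₊)/d)² − ¼`, and `K(r₊)/d = (ω − mω₊)/(2κ)` because
`r₊² + a² = 2Mr₊` (`Kerr.rPlus_sq_add_sq`), `ω₊ = a/(2Mr₊)` and `κ = d/(2(r₊² + a²))`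
(`Kerr.surfaceGravity_eq_rPlus_sub_rMinus_div`).

Pure calculus over the tree's Kerr vocabulary; no named fact is used.
-/

-- the doubled `FinalStateConjecture.FinalStateConjecture` path component trips dupNamespace
set_option linter.dupNamespace false

noncomputable section

namespace Summit.FinalStateConjecture.FinalStateConjecture.Theorems.KappaExplicitWaveDecay.OlverDunsterUniformReduction

open Literature.Geometry.Lorentzian
open MeasureTheory Filter Set Complex
open scoped Topology Manifold ENNReal

/-! ### The Liouville factor `ρ(y) = √(y(y+1))`, its inverse, and their first two derivatives -/

/-- `ρ′ = (2y + 1)/(2ρ)` at every `y > 0`. -/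
private theorem hasDerivAt_ρ {y : ℝ} (hy : 0 < y) :
    HasDerivAt (fun y : ℝ ↦ √(y * (y + 1))) ((2 * y + 1) / (2 * √(y * (y + 1)))) y := by
  have hP : HasDerivAt (fun y : ℝ ↦ y * (y + 1)) (2 * y + 1) y :=
    ((hasDerivAt_id' y).fun_mul ((hasDerivAt_id' y).add_const 1)).congr_deriv (by ring)
  exact hP.sqrt (by positivity)

/-- `ρ″ = −1/(4ρ³)` at every `y > 0` (this is where `(2y+1)² − 4y(y+1) = 1` enters). -/
private theorem hasDerivAt_ρ₁ {y : ℝ} (hy : 0 < y) :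
    HasDerivAt (fun y : ℝ ↦ (2 * y + 1) / (2 * √(y * (y + 1)))) (-1 / (4 * √(y * (y + 1)) ^ 3))
      y := by
  have hP : 0 < y * (y + 1) := by positivity
  have hρ : 0 < √(y * (y + 1)) := Real.sqrt_pos.2 hP
  have h2 : √(y * (y + 1)) ^ 2 = y * (y + 1) := Real.sq_sqrt hP.le
  have hN : HasDerivAt (fun y : ℝ ↦ 2 * y + 1) 2 y := by
    simpa using ((hasDerivAt_id' y).const_mul 2).add_const 1
  refine (hN.fun_div ((hasDerivAt_ρ hy).const_mul 2) (by positivity)).congr_deriv ?_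
  set ρ := √(y * (y + 1))
  field_simp
  linear_combination 16 * h2

/-- `(ρ⁻¹)′ = −ρ′/ρ²` at every `y > 0`. -/
private theorem hasDerivAt_σ {y : ℝ} (hy : 0 < y) :
    HasDerivAt (fun y : ℝ ↦ (√(y * (y + 1)))⁻¹)
      (-((2 * y + 1) / (2 * √(y * (y + 1)))) / √(y * (y + 1)) ^ 2) y :=
  (hasDerivAt_ρ hy).fun_inv (Real.sqrt_pos.2 (by positivity)).ne'

/-- `(ρ⁻¹)″ = (1 + 2(2y+1)²)/(4ρ⁵)` at every `y > 0`. -/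
private theorem hasDerivAt_σ₁ {y : ℝ} (hy : 0 < y) :
    HasDerivAt (fun y : ℝ ↦ -((2 * y + 1) / (2 * √(y * (y + 1)))) / √(y * (y + 1)) ^ 2)
      ((1 + 2 * (2 * y + 1) ^ 2) / (4 * √(y * (y + 1)) ^ 5)) y := by
  have hP : 0 < y * (y + 1) := by positivity
  have hρ : 0 < √(y * (y + 1)) := Real.sqrt_pos.2 hP
  refine ((hasDerivAt_ρ₁ hy).fun_neg.fun_div ((hasDerivAt_ρ hy).fun_pow 2)
    (by positivity)).congr_deriv ?_
  simp only [Nat.cast_ofNat, Nat.add_one_sub_one, pow_one]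
  set ρ := √(y * (y + 1))
  field_simp
  ring

/-! ### Product and chain rule: `z ↦ μ(z)·f(θ z)` differentiated twice at a point -/

/-- For `θ` with `θ′(y) = q`, `f` twice differentiable at `θ y` (derivatives `f′(θ y)`, `f″`) and a
real weight `μ` twice differentiable at `y` (derivatives `μ′ y`, `μ″`), the function
`z ↦ μ(z)·f(θ z)` has derivative `μ′f + μ·q f′` at `y`, and the latter (as a function of `z`) has
derivative `μ″ f + 2 μ′ q f′ + μ q² f″` at `y`. -/
private theorem hasDerivAt_liouville {f f' : ℝ → ℂ} {f'' : ℂ} {θ μ μ' : ℝ → ℝ} {μ'' q y : ℝ}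
    (hθ : HasDerivAt θ q y) (hf : HasDerivAt f (f' (θ y)) (θ y))
    (hf' : HasDerivAt f' f'' (θ y)) (hμ : HasDerivAt μ (μ' y) y) (hμ' : HasDerivAt μ' μ'' y) :
    HasDerivAt (fun z ↦ (μ z : ℂ) * f (θ z))
        ((μ' y : ℂ) * f (θ y) + (μ y : ℂ) * ((q : ℂ) * f' (θ y))) y ∧
      HasDerivAt (fun z ↦ (μ' z : ℂ) * f (θ z) + (μ z : ℂ) * ((q : ℂ) * f' (θ z)))
        ((μ'' : ℂ) * f (θ y) + 2 * ((μ' y : ℂ) * ((q : ℂ) * f' (θ y))) +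
          (μ y : ℂ) * ((q : ℂ) ^ 2 * f'')) y := by
  have h1 : HasDerivAt (fun z ↦ f (θ z)) ((q : ℂ) * f' (θ y)) y := by
    simpa [Function.comp_def, Complex.real_smul] using hf.scomp y hθ
  have h2 : HasDerivAt (fun z ↦ (q : ℂ) * f' (θ z)) ((q : ℂ) * ((q : ℂ) * f'')) y := by
    simpa [Function.comp_def, Complex.real_smul] using (hf'.scomp y hθ).const_mul (q : ℂ)
  exact ⟨hμ.ofReal_comp.fun_mul h1,
    ((hμ'.ofReal_comp.fun_mul h1).fun_add (hμ.ofReal_comp.fun_mul h2)).congr_deriv (by ring)⟩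

/-! ### The `s = 0` radial Teukolsky ODE, cleaned up -/

/-- With spin `s = 0` and `λ = Λ − a²ω²`, `Kerr.IsRadialTeukolskySolution` says exactly:
`Δ R″ + 2(r − M) R′ + (K²/Δ − (Λ − 2amω)) R = 0` on `r > r₊`. -/
private theorem isRadialTeukolskySolution_iff (M a ω m Λ : ℝ) (R : ℝ → ℂ) :
    Kerr.IsRadialTeukolskySolution M a 0 ω m (Λ - a ^ 2 * ω ^ 2) R ↔
      ∃ R' R'' : ℝ → ℂ, ∀ r : ℝ, Kerr.rPlus M a < r →
        HasDerivAt R (R' r) r ∧ HasDerivAt R' (R'' r) r ∧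
          (Kerr.delta M a r : ℂ) * R'' r + ((2 * (r - M) : ℝ) : ℂ) * R' r +
            ((Kerr.radialK a ω m r ^ 2 / Kerr.delta M a r - (Λ - 2 * a * m * ω) : ℝ) : ℂ) *
              R r = 0 := by
  unfold Kerr.IsRadialTeukolskySolution
  refine exists_congr fun R' ↦ exists_congr fun R'' ↦ forall_congr' fun r ↦
    forall_congr' fun _ ↦ ?_
  constructor <;> rintro ⟨h1, h2, h3⟩ <;> refine ⟨h1, h2, ?_⟩ <;>
    · push_cast at h3 ⊢
      linear_combination h3

/-! ### Part (i): the Liouville normal form in the blown-up radius -/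

/-- Part (i) of S1. -/
private theorem normalForm {M a : ℝ} (ha : |a| < M) (ω m Λ : ℝ) (R : ℝ → ℂ) :
    Kerr.IsRadialTeukolskySolution M a 0 ω m (Λ - a ^ 2 * ω ^ 2) R ↔
      ∃ W' W'' : ℝ → ℂ, ∀ x : ℝ, 0 < x →
        HasDerivAt (fun y : ℝ ↦ ((Real.sqrt (y * (y + 1)) : ℝ) : ℂ) *
            R (Kerr.rPlus M a + (Kerr.rPlus M a - Kerr.rMinus M a) * y)) (W' x) x ∧
          HasDerivAt W' (W'' x) x ∧
          W'' x =
            ((((Λ - 2 * a * m * ω) * (x * (x + 1)) -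
                    (Kerr.radialK a ω m (Kerr.rPlus M a + (Kerr.rPlus M a - Kerr.rMinus M a) * x) /
                        (Kerr.rPlus M a - Kerr.rMinus M a)) ^ 2 - 1 / 4) /
                  (x * (x + 1)) ^ 2 : ℝ) : ℂ) *
              (((Real.sqrt (x * (x + 1)) : ℝ) : ℂ) *
                R (Kerr.rPlus M a + (Kerr.rPlus M a - Kerr.rMinus M a) * x)) := by
  rw [isRadialTeukolskySolution_iff]
  set d := Kerr.rPlus M a - Kerr.rMinus M a with hd_def
  have hd : 0 < d := sub_pos.2 (Kerr.IsSubextremal.rMinus_lt_rPlus ha)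
  have hdM : Kerr.rPlus M a - M = d / 2 := by
    rw [hd_def, Kerr.rPlus_sub_rMinus, Kerr.rPlus_sub_self]; ring
  have hΔ : ∀ x : ℝ, Kerr.delta M a (Kerr.rPlus M a + d * x) = d ^ 2 * (x * (x + 1)) := fun x ↦ by
    rw [Kerr.delta_eq_mul ha.le, hd_def]; ring
  have hβ : ∀ x : ℝ, 2 * (Kerr.rPlus M a + d * x - M) = d * (2 * x + 1) := fun x ↦ by
    linear_combination 2 * hdM
  have hθ : ∀ x : ℝ, HasDerivAt (fun y : ℝ ↦ Kerr.rPlus M a + d * y) d x := fun x ↦ by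
    simpa using ((hasDerivAt_id' x).const_mul d).const_add (Kerr.rPlus M a)
  have hdC : (d : ℂ) ≠ 0 := by exact_mod_cast hd.ne'
  constructor
  · -- (→): `W = ρ · (R ∘ φ)`
    rintro ⟨R', R'', hR⟩
    refine ⟨fun y ↦ (((2 * y + 1) / (2 * √(y * (y + 1))) : ℝ) : ℂ) * R (Kerr.rPlus M a + d * y) +
        ((√(y * (y + 1)) : ℝ) : ℂ) * ((d : ℂ) * R' (Kerr.rPlus M a + d * y)),
      fun y ↦ ((-1 / (4 * √(y * (y + 1)) ^ 3) : ℝ) : ℂ) * R (Kerr.rPlus M a + d * y) +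
        2 * ((((2 * y + 1) / (2 * √(y * (y + 1))) : ℝ) : ℂ) *
          ((d : ℂ) * R' (Kerr.rPlus M a + d * y))) +
        ((√(y * (y + 1)) : ℝ) : ℂ) * ((d : ℂ) ^ 2 * R'' (Kerr.rPlus M a + d * y)),
      fun x hx ↦ ?_⟩
    have hr : Kerr.rPlus M a < Kerr.rPlus M a + d * x := lt_add_of_pos_right _ (mul_pos hd hx)
    obtain ⟨h1, h2, hode⟩ := hR _ hr
    obtain ⟨H1, H2⟩ := hasDerivAt_liouville (hθ x) h1 h2 (hasDerivAt_ρ hx) (hasDerivAt_ρ₁ hx)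
    refine ⟨H1, H2, ?_⟩
    rw [hΔ, hβ] at hode
    have hP : 0 < x * (x + 1) := by positivity
    beta_reduce
    set ρ := √(x * (x + 1)) with hρ_def
    have hρ : 0 < ρ := Real.sqrt_pos.2 hP
    have hρ2 : x * (x + 1) = ρ ^ 2 := (Real.sq_sqrt hP.le).symm
    have hρC : (ρ : ℂ) ≠ 0 := by exact_mod_cast hρ.ne'
    rw [hρ2] at hode ⊢
    linear_combination (norm := skip) (ρ : ℂ)⁻¹ * hode
    push_cast
    field_simp
    ring
  · -- (←): `R = (ρ⁻¹ · W) ∘ ψ` near every `r > r₊`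
    rintro ⟨W', W'', hW⟩
    set ψ : ℝ → ℝ := fun z ↦ (z - Kerr.rPlus M a) / d with hψ_def
    have hψ' : ∀ z, HasDerivAt ψ (1 / d) z := fun z ↦
      ((hasDerivAt_id' z).sub_const (Kerr.rPlus M a)).div_const d
    set W : ℝ → ℂ := fun y ↦ ((√(y * (y + 1)) : ℝ) : ℂ) * R (Kerr.rPlus M a + d * y) with hW_def
    set μ : ℝ → ℝ := fun z ↦ (√(ψ z * (ψ z + 1)))⁻¹ with hμ_def
    set μ' : ℝ → ℝ := fun z ↦
      -((2 * ψ z + 1) / (2 * √(ψ z * (ψ z + 1)))) / √(ψ z * (ψ z + 1)) ^ 2 * (1 / d) with hμ'_def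
    set μ'' : ℝ → ℝ := fun z ↦
      (1 + 2 * (2 * ψ z + 1) ^ 2) / (4 * √(ψ z * (ψ z + 1)) ^ 5) * (1 / d) * (1 / d) with hμ''_def
    refine ⟨fun z ↦ (μ' z : ℂ) * W (ψ z) + (μ z : ℂ) * (((1 / d : ℝ) : ℂ) * W' (ψ z)),
      fun z ↦ (μ'' z : ℂ) * W (ψ z) + 2 * ((μ' z : ℂ) * (((1 / d : ℝ) : ℂ) * W' (ψ z))) +
        (μ z : ℂ) * (((1 / d : ℝ) : ℂ) ^ 2 * W'' (ψ z)), ?_⟩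
    intro r hr
    obtain ⟨x, hx, rfl⟩ : ∃ x : ℝ, 0 < x ∧ r = Kerr.rPlus M a + d * x :=
      ⟨ψ r, div_pos (sub_pos.2 hr) hd, by simp only [hψ_def]; field_simp; ring⟩
    have hψx : ψ (Kerr.rPlus M a + d * x) = x := by simp only [hψ_def]; field_simp; ring
    have hxψ : 0 < ψ (Kerr.rPlus M a + d * x) := by rw [hψx]; exact hx
    obtain ⟨hW1, hW2, hW3⟩ := hW x hx
    have hf : HasDerivAt W (W' (ψ (Kerr.rPlus M a + d * x))) (ψ (Kerr.rPlus M a + d * x)) := by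
      rw [hψx]; exact hW1
    have hf' : HasDerivAt W' (W'' (ψ (Kerr.rPlus M a + d * x))) (ψ (Kerr.rPlus M a + d * x)) := by
      rw [hψx]; exact hW2
    have hμ : HasDerivAt μ (μ' (Kerr.rPlus M a + d * x)) (Kerr.rPlus M a + d * x) :=
      (hasDerivAt_σ hxψ).comp (Kerr.rPlus M a + d * x) (hψ' _)
    have hμ' : HasDerivAt μ' (μ'' (Kerr.rPlus M a + d * x)) (Kerr.rPlus M a + d * x) :=
      ((hasDerivAt_σ₁ hxψ).comp (Kerr.rPlus M a + d * x) (hψ' _)).mul_const (1 / d)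
    obtain ⟨H1, H2⟩ := hasDerivAt_liouville (hψ' _) hf hf' hμ hμ'
    refine ⟨H1.congr_of_eventuallyEq ?_, H2, ?_⟩
    · -- `R` agrees with `(ρ⁻¹ W) ∘ ψ` on the open half-line `r > r₊`
      filter_upwards [Ioi_mem_nhds hr] with z hz
      have hz' : 0 < ψ z := div_pos (sub_pos.2 hz) hd
      have hρz : √(ψ z * (ψ z + 1)) ≠ 0 := (Real.sqrt_pos.2 (by positivity)).ne'
      have hφψ : Kerr.rPlus M a + d * ψ z = z := by simp only [hψ_def]; field_simp; ring
      simp only [hμ_def, hW_def, hφψ]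
      rw [← mul_assoc, ← Complex.ofReal_mul, inv_mul_cancel₀ hρz, Complex.ofReal_one, one_mul]
    · -- the radial ODE at `r = φ x`
      rw [hΔ, hβ]
      have hP : 0 < x * (x + 1) := by positivity
      simp only [hμ_def, hμ'_def, hμ''_def, hW_def, hψx]
      rw [hW3]
      set ρ := √(x * (x + 1)) with hρ_def
      have hρ : 0 < ρ := Real.sqrt_pos.2 hP
      have hρ2 : x * (x + 1) = ρ ^ 2 := (Real.sq_sqrt hP.le).symm
      have hρC : (ρ : ℂ) ≠ 0 := by exact_mod_cast hρ.ne'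
      rw [hρ2]
      push_cast
      field_simp
      ring

/-! ### Part (ii): the horizon is a double pole, `x²·coef(x) → −ξ² − ¼` -/

/-- Part (ii) of S1. -/
private theorem doublePole {M a : ℝ} (hM : 0 < M) (ha : |a| < M) (ω m Λ : ℝ) :
    Tendsto
      (fun x : ℝ ↦ x ^ 2 *
        (((Λ - 2 * a * m * ω) * (x * (x + 1)) -
              (Kerr.radialK a ω m (Kerr.rPlus M a + (Kerr.rPlus M a - Kerr.rMinus M a) * x) /
                  (Kerr.rPlus M a - Kerr.rMinus M a)) ^ 2 - 1 / 4) /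
            (x * (x + 1)) ^ 2))
      (𝓝[>] 0)
      (𝓝 (-((ω - m * Kerr.horizonAngularVelocity M a) / (2 * Kerr.surfaceGravity M a)) ^ 2 -
        1 / 4)) := by
  set d := Kerr.rPlus M a - Kerr.rMinus M a with hd_def
  have hd : d ≠ 0 := (sub_pos.2 (Kerr.IsSubextremal.rMinus_lt_rPlus ha)).ne'
  have hA : Kerr.rPlus M a ^ 2 + a ^ 2 ≠ 0 := by
    have := Kerr.rPlus_pos hM a; positivity
  -- the horizon value `K(r₊)/(r₊ − r₋) = (ω − mω₊)/(2κ)`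
  have key : Kerr.radialK a ω m (Kerr.rPlus M a) / d =
      (ω - m * Kerr.horizonAngularVelocity M a) / (2 * Kerr.surfaceGravity M a) := by
    rw [Kerr.surfaceGravity_eq_rPlus_sub_rMinus_div, ← hd_def, Kerr.horizonAngularVelocity,
      ← Kerr.rPlus_sq_add_sq ha.le, Kerr.radialK]
    field_simp
  -- the regular factor `g = (Λ′x(x+1) − (K/d)² − ¼)/(x+1)²`
  set g : ℝ → ℝ := fun x ↦ ((Λ - 2 * a * m * ω) * (x * (x + 1)) -
      (Kerr.radialK a ω m (Kerr.rPlus M a + d * x) / d) ^ 2 - 1 / 4) / (x + 1) ^ 2 with hg_def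
  have hg : ContinuousAt g 0 := by
    simp only [hg_def, Kerr.radialK]
    fun_prop (disch := norm_num)
  have hg0 : g 0 =
      -((ω - m * Kerr.horizonAngularVelocity M a) / (2 * Kerr.surfaceGravity M a)) ^ 2 - 1 / 4 := by
    simp only [hg_def, mul_zero, add_zero, zero_mul, zero_sub, zero_add, one_pow, div_one, key]
  have hlim : Tendsto g (𝓝[>] 0) (𝓝 (g 0)) := hg.tendsto.mono_left nhdsWithin_le_nhds
  rw [hg0] at hlim
  refine hlim.congr' ?_
  filter_upwards [self_mem_nhdsWithin] with x hx
  have hx0 : x ≠ 0 := ne_of_gt hx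
  have hx1 : x + 1 ≠ 0 := by have : (0 : ℝ) < x := hx; positivity
  simp only [hg_def]
  field_simp

/-! ### The registered stub -/

/-- **S1 · `stub_olverNormalForm`.** (i) For `M > 0`, `|a| < M` and any `R : ℝ → ℂ`, `R` solves
the scalar radial Teukolsky ODE with `λ = Λ − a²ω²` iff `W(x) = √(x(x+1))·R(r₊ + (r₊ − r₋)x)` is
twice differentiable on `x > 0` with `W″ = (((Λ − 2amω)x(x+1) − (K/(r₊ − r₋))² − ¼)/(x(x+1))²)·W`;
(ii) `x²` times that coefficient tends to `−((ω − mω₊)/(2κ))² − ¼` as `x → 0⁺`. -/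
theorem stub_olverNormalForm :
    (∀ (M a ω m Λ : ℝ), 0 < M → |a| < M → ∀ R : ℝ → ℂ,
        (Kerr.IsRadialTeukolskySolution M a 0 ω m (Λ - a ^ 2 * ω ^ 2) R ↔
          ∃ W' W'' : ℝ → ℂ, ∀ x : ℝ, 0 < x →
            HasDerivAt (fun y : ℝ ↦ ((Real.sqrt (y * (y + 1)) : ℝ) : ℂ) *
                R (Kerr.rPlus M a + (Kerr.rPlus M a - Kerr.rMinus M a) * y)) (W' x) x ∧
              HasDerivAt W' (W'' x) x ∧
              W'' x =
                ((((Λ - 2 * a * m * ω) * (x * (x + 1)) -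
                        (Kerr.radialK a ω m (Kerr.rPlus M a + (Kerr.rPlus M a - Kerr.rMinus M a) * x) /
                            (Kerr.rPlus M a - Kerr.rMinus M a)) ^ 2 - 1 / 4) /
                      (x * (x + 1)) ^ 2 : ℝ) : ℂ) *
                  (((Real.sqrt (x * (x + 1)) : ℝ) : ℂ) * R (Kerr.rPlus M a + (Kerr.rPlus M a - Kerr.rMinus M a) * x)))) ∧
      (∀ (M a ω m Λ : ℝ), 0 < M → |a| < M →
        Tendsto
          (fun x : ℝ ↦ x ^ 2 *
            (((Λ - 2 * a * m * ω) * (x * (x + 1)) -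
                  (Kerr.radialK a ω m (Kerr.rPlus M a + (Kerr.rPlus M a - Kerr.rMinus M a) * x) /
                      (Kerr.rPlus M a - Kerr.rMinus M a)) ^ 2 - 1 / 4) /
                (x * (x + 1)) ^ 2))
          (𝓝[>] 0)
          (𝓝 (-((ω - m * Kerr.horizonAngularVelocity M a) / (2 * Kerr.surfaceGravity M a)) ^ 2 - 1 / 4))) :=
  ⟨fun _ _ ω m Λ _ ha R ↦ normalForm ha ω m Λ R, fun _ _ ω m Λ hM ha ↦ doublePole hM ha ω m Λ⟩

end Summit.FinalStateConjecture.FinalStateConjecture.Theorems.KappaExplicitWaveDecay.OlverDunsterUniformReduction
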